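import Mathlib
import Literature.Analysis.FluidPDE.SelfSimilar
import Summits.NavierStokesRegularity.NavierStokesRegularity.Theorems.LandauTailLandauTailBlowupGradientDyadic

/-!
# Rescaled energy bookkeeping for the Navier–Stokes rescalings `u_λ = nsRescale λ u`

Helper file for crux `LandauTailBlowup` (stmt-NavierStokesRegularity-1944), line `registered`,
registered stub `landauTail_rescaled_energy_le` (W5, "rescaled energy bookkeeping").

Claim.  If `∫_{B_1} ‖u(t)‖² ≤ C` for every `t ∈ (−1, 0)`, then for `0 < λ ≤ 1`, every radius
`R > 0` with `R λ ≤ 1` and every `s ∈ (−1, 0)` the parabolic rescaling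
`u_λ (s, y) = λ u(λ² s, λ y)` (`Literature.Analysis.FluidPDE.nsRescale λ u`) satisfies
`∫_{B_R} ‖u_λ(s)‖² ≤ C / λ`.

Proof (folklore; scaling of the local energy).  Pointwise `‖u_λ(s, y)‖² = λ² ‖u(λ² s, λ y)‖²`;
the dilation `x = λ y` of the ball (Jacobian `λ³`,
`landauTail_gradDyadic_setLIntegral_ball_smul`) gives
`∫_{B_R} ‖u_λ(s)‖² = λ² · λ⁻³ ∫_{B_{λR}} ‖u(λ² s)‖² = λ⁻¹ ∫_{B_{λR}} ‖u(λ² s)‖²`, and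
`B_{λR} ⊆ B_1`, `λ² s ∈ (−1, 0)`.
-/

set_option linter.dupNamespace false

namespace Summit.NavierStokesRegularity.NavierStokesRegularity.Theorems

open MeasureTheory Set Metric Literature.Analysis.FluidPDE
open scoped ENNReal NNReal

/-- **W5 — rescaled energy bookkeeping** (registered stub W5 of crux `LandauTailBlowup`,
stmt-NavierStokesRegularity-1944): under the bound `∫_{B₁} ‖u(t)‖² ≤ C` for all `t ∈ (−1, 0)`,
the parabolic rescaling `u_λ(s, y) = λ u(λ² s, λ y)` (`nsRescale λ u`), `0 < λ ≤ 1`, has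
`∫_{B_R} ‖u_λ(s)‖² ≤ C / λ` for every `s ∈ (−1, 0)` and every radius `R > 0` with `R λ ≤ 1`
(change of variables `x = λ y`, Jacobian `λ³`, against the prefactor `λ²`; then
`B_{λR} ⊆ B_1` and `λ² s ∈ (−1, 0)`). [folklore] -/
theorem landauTail_rescaled_energy_le : ∀ (u : ℝ → EuclideanSpace ℝ (Fin 3) → EuclideanSpace ℝ (Fin 3)) (C : NNReal), (∀ t ∈ Set.Ioo (-1 : ℝ) 0, ∫⁻ x in Metric.ball (0 : EuclideanSpace ℝ (Fin 3)) 1, ‖u t x‖ₑ ^ 2 ≤ C) → ∀ lam : ℝ, 0 < lam → lam ≤ 1 → ∀ R : ℝ, 0 < R → R * lam ≤ 1 → ∀ s ∈ Set.Ioo (-1 : ℝ) 0, ∫⁻ x in Metric.ball (0 : EuclideanSpace ℝ (Fin 3)) R, ‖Literature.Analysis.FluidPDE.nsRescale lam u s x‖ₑ ^ 2 ≤ ENNReal.ofReal lam⁻¹ * C := by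
  intro u C hC lam hlam hlam1 R _hR hRlam s hs
  -- the rescaled time `lam² s` lies in `(-1, 0)`
  have ht : lam ^ 2 * s ∈ Set.Ioo (-1 : ℝ) 0 := by
    obtain ⟨hs1, hs0⟩ := hs
    have hl2 : 0 < lam ^ 2 := pow_pos hlam 2
    have hl21 : lam ^ 2 ≤ 1 := pow_le_one₀ hlam.le hlam1
    refine ⟨?_, mul_neg_of_pos_of_neg hl2 hs0⟩
    nlinarith
  -- pointwise: the integrand is `lam² ‖u (lam² s) (lam • x)‖²`
  have hpt : ∀ x : EuclideanSpace ℝ (Fin 3),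
      ‖nsRescale lam u s x‖ₑ ^ 2 =
        ENNReal.ofReal (lam ^ 2) * ‖u (lam ^ 2 * s) (lam • x)‖ₑ ^ 2 := by
    intro x
    rw [nsRescale_apply, enorm_smul, mul_pow, Real.enorm_eq_ofReal hlam.le,
      ENNReal.ofReal_pow hlam.le]
  -- the dilation `x = lam • y` of the ball, Jacobian `lam³`
  have hball : ∫⁻ y in ball (0 : EuclideanSpace ℝ (Fin 3)) (lam * R), ‖u (lam ^ 2 * s) y‖ₑ ^ 2 =
      ENNReal.ofReal (lam ^ 3) *
        ∫⁻ x in ball (0 : EuclideanSpace ℝ (Fin 3)) R, ‖u (lam ^ 2 * s) (lam • x)‖ₑ ^ 2 := by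
    have h := landauTail_gradDyadic_setLIntegral_ball_smul
      (fun y => ‖u (lam ^ 2 * s) y‖ₑ ^ 2) hlam 0 R
    rwa [smul_zero] at h
  have hsub : ball (0 : EuclideanSpace ℝ (Fin 3)) (lam * R) ⊆ ball 0 1 :=
    ball_subset_ball (by rw [mul_comm]; exact hRlam)
  calc ∫⁻ x in ball (0 : EuclideanSpace ℝ (Fin 3)) R, ‖nsRescale lam u s x‖ₑ ^ 2
      = ∫⁻ x in ball (0 : EuclideanSpace ℝ (Fin 3)) R,
          ENNReal.ofReal (lam ^ 2) * ‖u (lam ^ 2 * s) (lam • x)‖ₑ ^ 2 :=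
        lintegral_congr fun x => hpt x
    _ = ENNReal.ofReal (lam ^ 2) *
          ∫⁻ x in ball (0 : EuclideanSpace ℝ (Fin 3)) R, ‖u (lam ^ 2 * s) (lam • x)‖ₑ ^ 2 :=
        lintegral_const_mul' _ _ ENNReal.ofReal_ne_top
    _ = ENNReal.ofReal lam⁻¹ * (ENNReal.ofReal (lam ^ 3) *
          ∫⁻ x in ball (0 : EuclideanSpace ℝ (Fin 3)) R, ‖u (lam ^ 2 * s) (lam • x)‖ₑ ^ 2) := by
        rw [← mul_assoc, ← ENNReal.ofReal_mul (inv_nonneg.2 hlam.le)]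
        congr 2
        field_simp
    _ = ENNReal.ofReal lam⁻¹ *
          ∫⁻ y in ball (0 : EuclideanSpace ℝ (Fin 3)) (lam * R), ‖u (lam ^ 2 * s) y‖ₑ ^ 2 := by
        rw [hball]
    _ ≤ ENNReal.ofReal lam⁻¹ *
          ∫⁻ y in ball (0 : EuclideanSpace ℝ (Fin 3)) 1, ‖u (lam ^ 2 * s) y‖ₑ ^ 2 :=
        mul_le_mul_right (lintegral_mono_set hsub) _
    _ ≤ ENNReal.ofReal lam⁻¹ * C :=
        mul_le_mul_right (hC _ ht) _

end Summit.NavierStokesRegularity.NavierStokesRegularity.Theorems
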